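import Mathlib
import Summits.MatrixMultiplication.MatrixMultiplication.Theses.LevelGradedCohnUmans
import Summits.MatrixMultiplication.MatrixMultiplication.Theorems.LevelGradedCohnUmansGradedDesignFamilyWreathLink
import Summits.MatrixMultiplication.MatrixMultiplication.Theorems.LevelGradedCohnUmansGradedDesignFamilyStubShareUniversality
import Summits.MatrixMultiplication.MatrixMultiplication.Theorems.GradedPricing.Negative.LoadBearing

/-!
# Line `Sketch` (cards `graded-stpp-wreath` ≈ `graded-simultaneity-wreath-lift`) — skeleton v4 for the
# crux `LevelGradedCohnUmans.GradedDesignFamily` (stmt-MatrixMultiplication-7610)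

(v5 = v4 with the content of the LANDED `…GradedDesignFamilySharedWallLink.lean` (p94740) inlined verbatim, so that
this workfile elaborates before the hub has built that module's olean.)

CLOSED MODULO ONE STUB.  Composition `GradedDesignFamily_of : GradedDesignFamily` :=
`gradedDesignFamily_of_lieCellFamilies stub_lieCellFamilies`, where everything except
`stub_lieCellFamilies` is LANDED in `Theorems/`:

* the graded CKSU wreath lift `gradedWreathLinkAt` / `gradedWreathLink_proof` /
  `gradedDesignFamily_iff_simultaneousFamily` (`…GradedDesignFamilyWreathLink.lean`), composed of the six
  wave-1 stubs `stub_powerSep` p86216, `stub_prodBudget` p86699, `stub_powerBudget` p87165,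
  `stub_wreathSep` p86522, `stub_wreathBudget` p90940 (+ `wreathBudget_index_le` p86956), `stub_amplify` p87006;
* the host-free accounting `stub_shareUniversality` p92526 and the Lie-cell glue
  `gradedDesignFamily_of_sharedWall`, `gradedDesignFamily_of_lieCellFamilies`
  (`…GradedDesignFamilySharedWallLink.lean`);
* calibration: `abelianAxisFamily_of_le` p92081 + `cruxAt_of_le_082` (the crux's clause at every
  `ε ≥ 0.82` from an ABELIAN base through the lift; single abelian designs stop at `ε > 1`).

History: v1/v2 (06:23) 7 stubs (6 lift pieces + `stub_engine`); wave 1 landed the six; v3 (08:50)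
RESHAPED `stub_engine` ↦ `stub_shareUniversality` + `stub_lieCellFamilies` along the crux-plan line
`Lines/graded_stpp_wreath.lean` (planner statements verbatim); wave 2 landed `stub_shareUniversality`.
The one open stub is the line's (and the crux's) mathematics: shared-wall graded STPP families in the
Lie cells — weaker than the route's crux `LevelOneGL2Designs` (its `t = 1`, `(2,1)` instance), new in
the freedom `t > 1`.
-/

noncomputable section

set_option linter.dupNamespace false

open scoped BigOperators
open Literature.RepresentationTheory.FiniteGroups
open Summit.MatrixMultiplication.MatrixMultiplication.Theses.LevelGradedCohnUmans

namespace Summit.MatrixMultiplication.MatrixMultiplication.Theorems.GradedDesignFamily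

/-! ## The one registered open stub -/

/-- **stub_lieCellFamilies (XL, HARDEST, OPEN) — shared-wall families in the Lie cells**: a fixed
filling fraction `c > 0` and, for every ratio `R`, a cell `(p, m, k)`, `t ≥ 1` and `t` blocks
`(X_i, Y_i, Z_i)` in `GL_m(𝔽_p)` simultaneously separated by the Fourier-rank-`≤ k` test space
`F = span{g ↦ ψ(tr(M g)) : rk M ≤ k}`, each of volume `≥ c (B₂/t)^{3/2}` (`B₂ = Σ_{Irr ∩ F} χ(1)²`),
with `R t χ(1)² ≤ B₂` for every `χ ∈ Irr ∩ F` (i.e. `t ≤ N_eff/R`).  Its instance `t = 1`,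
`(m,k) = (2,1)` is implied by the route's crux `LevelOneGL2Designs` (stmt-MatrixMultiplication-14080)
given the level-one character facts of `LevelOneLink` (stmt-14082); the freedom `t > 1` is what the
line adds.  Statement by planner-cruxplan-stmt-MatrixMultiplication-7610-graded-stpp-wreath-0 (verbatim).
[cite: CohnKleinbergSzegedyUmans2005, Thm. 7.1] -/
theorem stub_lieCellFamilies :
    ∃ c : ℝ, 0 < c ∧ ∀ R : ℝ, ∃ (p : ℕ) (_ : Fact p.Prime) (m k : ℕ)
      (F : Submodule ℂ (Matrix.GeneralLinearGroup (Fin m) (ZMod p) → ℂ)) (B₂ : ℝ) (t : ℕ)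
      (X Y Z : Fin t → Finset (Matrix.GeneralLinearGroup (Fin m) (ZMod p))),
      F = Submodule.span ℂ {f | ∃ M : Matrix (Fin m) (Fin m) (ZMod p), M.rank ≤ k ∧
        f = fun g : Matrix.GeneralLinearGroup (Fin m) (ZMod p) =>
          (ZMod.stdAddChar (Matrix.trace (M * (g : Matrix (Fin m) (Fin m) (ZMod p)))) : ℂ)} ∧
      B₂ = (∑ᶠ χ ∈ Literature.RepresentationTheory.FiniteGroups.irrChars
          (Matrix.GeneralLinearGroup (Fin m) (ZMod p)) ∩
        (F : Set (Matrix.GeneralLinearGroup (Fin m) (ZMod p) → ℂ)), (χ 1).re ^ (2 : ℝ)) ∧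
      (∀ i : Fin t, ∀ x₀ ∈ X i, ∀ z₀ ∈ Z i, ∃ f ∈ F, ∀ j k : Fin t,
        ∀ x ∈ X j, ∀ y ∈ Y j, ∀ y' ∈ Y k, ∀ z ∈ Z k,
          ((j = i ∧ k = i ∧ x = x₀ ∧ y = y' ∧ z = z₀) → f (x⁻¹ * y * y'⁻¹ * z) = 1) ∧
          (¬ (j = i ∧ k = i ∧ x = x₀ ∧ y = y' ∧ z = z₀) → f (x⁻¹ * y * y'⁻¹ * z) = 0)) ∧
      1 ≤ t ∧
      (∀ i, c * (B₂ / t) ^ (3 / 2 : ℝ) ≤ ((((X i).card * (Y i).card * (Z i).card : ℕ) : ℝ))) ∧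
      (∀ χ ∈ Literature.RepresentationTheory.FiniteGroups.irrChars
          (Matrix.GeneralLinearGroup (Fin m) (ZMod p)) ∩
          (F : Set (Matrix.GeneralLinearGroup (Fin m) (ZMod p) → ℂ)),
        R * t * (χ 1).re ^ 2 ≤ B₂) := by
  sorry

/-! ## Shared-wall link (landed as `…GradedDesignFamilySharedWallLink.lean`, p94740, there concluding the crux BY NAME as
`gradedDesignFamily_of_sharedWall` / `gradedDesignFamily_of_lieCellFamilies`; inlined here with the crux UNFOLDED so that
`GradedDesignFamily_of` is the only declaration of this workfile concluding the crux by name) -/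


/-- **Shared-wall families imply the crux** (`stub_shareUniversality ∘ gradedWreathLinkAt`).
[cite: CohnKleinbergSzegedyUmans2005, Thm. 5.5] -/
theorem sharedWall_gives_crux_unfolded (c : ℝ) (hc : 0 < c)
    (hfam : ∀ R : ℝ, ∃ (G : Type) (_ : Group G) (_ : Fintype G) (J : Submodule ℂ (G → ℂ))
      (B₂ : ℝ) (t : ℕ) (X Y Z : Fin t → Finset G),
      B₂ = (∑ᶠ χ ∈ Literature.RepresentationTheory.FiniteGroups.irrChars G ∩ (J : Set (G → ℂ)),
        (χ 1).re ^ (2 : ℝ)) ∧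
      (∀ f ∈ J, ∀ a b : G, (fun g : G => f (a * g * b)) ∈ J) ∧
      (∀ i : Fin t, ∀ x₀ ∈ X i, ∀ z₀ ∈ Z i, ∃ f ∈ J, ∀ j k : Fin t,
        ∀ x ∈ X j, ∀ y ∈ Y j, ∀ y' ∈ Y k, ∀ z ∈ Z k,
          ((j = i ∧ k = i ∧ x = x₀ ∧ y = y' ∧ z = z₀) → f (x⁻¹ * y * y'⁻¹ * z) = 1) ∧
          (¬ (j = i ∧ k = i ∧ x = x₀ ∧ y = y' ∧ z = z₀) → f (x⁻¹ * y * y'⁻¹ * z) = 0)) ∧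
      1 ≤ t ∧ 0 < B₂ ∧
      (∀ i, c * (B₂ / t) ^ (3 / 2 : ℝ) ≤ ((((X i).card * (Y i).card * (Z i).card : ℕ) : ℝ))) ∧
      (∀ χ ∈ Literature.RepresentationTheory.FiniteGroups.irrChars G ∩ (J : Set (G → ℂ)),
        R * t * (χ 1).re ^ 2 ≤ B₂)) :
    (∀ ε : ℝ, 0 < ε → ∃ (G : Type) (_ : Group G) (_ : Fintype G) (J : Submodule ℂ (G → ℂ))
      (X Y Z : Finset G), (∀ f ∈ J, ∀ a b : G, (fun g : G => f (a * g * b)) ∈ J) ∧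
      (∀ x₀ ∈ X, ∀ z₀ ∈ Z, ∃ f ∈ J, ∀ x ∈ X, ∀ y ∈ Y, ∀ y' ∈ Y, ∀ z ∈ Z,
        (x = x₀ ∧ y = y' ∧ z = z₀ → f (x⁻¹ * y * y'⁻¹ * z) = 1) ∧
        (¬ (x = x₀ ∧ y = y' ∧ z = z₀) → f (x⁻¹ * y * y'⁻¹ * z) = 0)) ∧
      (∑ᶠ χ ∈ Literature.RepresentationTheory.FiniteGroups.irrChars G ∩ (J : Set (G → ℂ)),
        (χ 1).re ^ (2 + ε)) < ((X.card * Y.card * Z.card : ℕ) : ℝ) ^ ((2 + ε) / 3)) := by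
  intro ε hε
  exact gradedWreathLinkAt ε hε.le (stub_shareUniversality c hc hfam ε hε)

/-- The Fourier-rank-`≤ k` test space of `GL_m(𝔽_p)` (span form) is bi-invariant:
`tr(M · (a g b)) = tr((b M a) · g)` and `rk(b M a) ≤ rk M`. [folklore] -/
theorem rankSpan_biInvariant (p m k : ℕ) [Fact p.Prime] :
    ∀ f ∈ Submodule.span ℂ {f | ∃ M : Matrix (Fin m) (Fin m) (ZMod p), M.rank ≤ k ∧
        f = fun g : Matrix.GeneralLinearGroup (Fin m) (ZMod p) =>
          (ZMod.stdAddChar (Matrix.trace (M * (g : Matrix (Fin m) (Fin m) (ZMod p)))) : ℂ)},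
      ∀ a b : Matrix.GeneralLinearGroup (Fin m) (ZMod p),
        (fun g : Matrix.GeneralLinearGroup (Fin m) (ZMod p) => f (a * g * b)) ∈
          Submodule.span ℂ {f | ∃ M : Matrix (Fin m) (Fin m) (ZMod p), M.rank ≤ k ∧
            f = fun g : Matrix.GeneralLinearGroup (Fin m) (ZMod p) =>
              (ZMod.stdAddChar (Matrix.trace (M * (g : Matrix (Fin m) (Fin m) (ZMod p)))) : ℂ)} := by
  intro f hf a b
  induction hf using Submodule.span_induction with
  | mem f hfS =>
      obtain ⟨M, hM, rfl⟩ := hfS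
      apply Submodule.subset_span
      refine ⟨(b : Matrix (Fin m) (Fin m) (ZMod p)) * M * (a : Matrix (Fin m) (Fin m) (ZMod p)),
        (Matrix.rank_mul_le_left _ _).trans ((Matrix.rank_mul_le_right _ _).trans hM), ?_⟩
      funext g
      have htr : Matrix.trace (M * ((a : Matrix (Fin m) (Fin m) (ZMod p)) *
          (g : Matrix (Fin m) (Fin m) (ZMod p)) * (b : Matrix (Fin m) (Fin m) (ZMod p)))) =
          Matrix.trace ((b : Matrix (Fin m) (Fin m) (ZMod p)) * M *
            (a : Matrix (Fin m) (Fin m) (ZMod p)) * (g : Matrix (Fin m) (Fin m) (ZMod p))) := by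
        rw [show M * ((a : Matrix (Fin m) (Fin m) (ZMod p)) * (g : Matrix (Fin m) (Fin m) (ZMod p)) *
            (b : Matrix (Fin m) (Fin m) (ZMod p))) =
            (M * (a : Matrix (Fin m) (Fin m) (ZMod p)) * (g : Matrix (Fin m) (Fin m) (ZMod p))) *
              (b : Matrix (Fin m) (Fin m) (ZMod p)) by simp only [mul_assoc],
          Matrix.trace_mul_comm]
        simp only [mul_assoc]
      show (ZMod.stdAddChar (Matrix.trace (M * ((a * g * b : Matrix.GeneralLinearGroup (Fin m) (ZMod p)) :
          Matrix (Fin m) (Fin m) (ZMod p)))) : ℂ) = _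
      rw [Units.val_mul, Units.val_mul, htr]
  | zero => exact Submodule.zero_mem _
  | add f g _ _ hf hg => exact Submodule.add_mem _ hf hg
  | smul c f _ hf => exact Submodule.smul_mem _ c hf

/-- The trivial character lies in the rank-`≤ k` span (`M = 0`), so its wall `B₂ = Σ_{Irr ∩ F} d²`
is positive. [folklore] -/
theorem rankSpan_wall_pos (p m k : ℕ) [Fact p.Prime] :
    0 < ∑ᶠ χ ∈ irrChars (Matrix.GeneralLinearGroup (Fin m) (ZMod p)) ∩
      ((Submodule.span ℂ {f | ∃ M : Matrix (Fin m) (Fin m) (ZMod p), M.rank ≤ k ∧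
        f = fun g : Matrix.GeneralLinearGroup (Fin m) (ZMod p) =>
          (ZMod.stdAddChar (Matrix.trace (M * (g : Matrix (Fin m) (Fin m) (ZMod p)))) : ℂ)} :
        Submodule ℂ (Matrix.GeneralLinearGroup (Fin m) (ZMod p) → ℂ)) :
          Set (Matrix.GeneralLinearGroup (Fin m) (ZMod p) → ℂ)), (χ 1).re ^ (2 : ℝ) := by
  set F : Submodule ℂ (Matrix.GeneralLinearGroup (Fin m) (ZMod p) → ℂ) :=
    Submodule.span ℂ {f | ∃ M : Matrix (Fin m) (Fin m) (ZMod p), M.rank ≤ k ∧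
      f = fun g : Matrix.GeneralLinearGroup (Fin m) (ZMod p) =>
        (ZMod.stdAddChar (Matrix.trace (M * (g : Matrix (Fin m) (Fin m) (ZMod p)))) : ℂ)} with hF
  have h1 : (1 : Matrix.GeneralLinearGroup (Fin m) (ZMod p) → ℂ) ∈ F := by
    apply Submodule.subset_span
    refine ⟨0, by simp, ?_⟩
    funext g
    simp
  have hmem : (1 : Matrix.GeneralLinearGroup (Fin m) (ZMod p) → ℂ) ∈
      irrChars (Matrix.GeneralLinearGroup (Fin m) (ZMod p)) ∩
        (F : Set (Matrix.GeneralLinearGroup (Fin m) (ZMod p) → ℂ)) :=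
    ⟨Summit.MatrixMultiplication.MatrixMultiplication.Theorems.GradedPricing.Negative.one_mem_irrChars,
      h1⟩
  have hfin : (irrChars (Matrix.GeneralLinearGroup (Fin m) (ZMod p)) ∩
      (F : Set (Matrix.GeneralLinearGroup (Fin m) (ZMod p) → ℂ))).Finite :=
    (irrChars_finite_holds _).subset Set.inter_subset_left
  rw [finsum_mem_eq_finite_toFinset_sum _ hfin]
  have hle : ((1 : Matrix.GeneralLinearGroup (Fin m) (ZMod p) → ℂ) 1).re ^ (2 : ℝ) ≤
      ∑ χ ∈ hfin.toFinset, (χ 1).re ^ (2 : ℝ) := by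
    refine Finset.single_le_sum (f := fun χ : Matrix.GeneralLinearGroup (Fin m) (ZMod p) → ℂ =>
      (χ 1).re ^ (2 : ℝ)) (fun χ hχ => ?_) (hfin.mem_toFinset.2 hmem)
    exact Real.rpow_nonneg (zero_le_one.trans (wreathBudget_one_le_re (hfin.mem_toFinset.1 hχ).1)) _
  refine lt_of_lt_of_le ?_ hle
  simp

/-- **The Lie-cell shared-wall families of the line's open stub imply the crux**
(`rankSpan_biInvariant`, `rankSpan_wall_pos`, then `gradedDesignFamily_of_sharedWall`).
[cite: CohnKleinbergSzegedyUmans2005, Thm. 7.1] -/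
theorem lieCellFamilies_give_crux_unfolded
    (hlie : ∃ c : ℝ, 0 < c ∧ ∀ R : ℝ, ∃ (p : ℕ) (_ : Fact p.Prime) (m k : ℕ)
      (F : Submodule ℂ (Matrix.GeneralLinearGroup (Fin m) (ZMod p) → ℂ)) (B₂ : ℝ) (t : ℕ)
      (X Y Z : Fin t → Finset (Matrix.GeneralLinearGroup (Fin m) (ZMod p))),
      F = Submodule.span ℂ {f | ∃ M : Matrix (Fin m) (Fin m) (ZMod p), M.rank ≤ k ∧
        f = fun g : Matrix.GeneralLinearGroup (Fin m) (ZMod p) =>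
          (ZMod.stdAddChar (Matrix.trace (M * (g : Matrix (Fin m) (Fin m) (ZMod p)))) : ℂ)} ∧
      B₂ = (∑ᶠ χ ∈ Literature.RepresentationTheory.FiniteGroups.irrChars
          (Matrix.GeneralLinearGroup (Fin m) (ZMod p)) ∩
        (F : Set (Matrix.GeneralLinearGroup (Fin m) (ZMod p) → ℂ)), (χ 1).re ^ (2 : ℝ)) ∧
      (∀ i : Fin t, ∀ x₀ ∈ X i, ∀ z₀ ∈ Z i, ∃ f ∈ F, ∀ j k : Fin t,
        ∀ x ∈ X j, ∀ y ∈ Y j, ∀ y' ∈ Y k, ∀ z ∈ Z k,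
          ((j = i ∧ k = i ∧ x = x₀ ∧ y = y' ∧ z = z₀) → f (x⁻¹ * y * y'⁻¹ * z) = 1) ∧
          (¬ (j = i ∧ k = i ∧ x = x₀ ∧ y = y' ∧ z = z₀) → f (x⁻¹ * y * y'⁻¹ * z) = 0)) ∧
      1 ≤ t ∧
      (∀ i, c * (B₂ / t) ^ (3 / 2 : ℝ) ≤ ((((X i).card * (Y i).card * (Z i).card : ℕ) : ℝ))) ∧
      (∀ χ ∈ Literature.RepresentationTheory.FiniteGroups.irrChars
          (Matrix.GeneralLinearGroup (Fin m) (ZMod p)) ∩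
          (F : Set (Matrix.GeneralLinearGroup (Fin m) (ZMod p) → ℂ)),
        R * t * (χ 1).re ^ 2 ≤ B₂)) :
    (∀ ε : ℝ, 0 < ε → ∃ (G : Type) (_ : Group G) (_ : Fintype G) (J : Submodule ℂ (G → ℂ))
      (X Y Z : Finset G), (∀ f ∈ J, ∀ a b : G, (fun g : G => f (a * g * b)) ∈ J) ∧
      (∀ x₀ ∈ X, ∀ z₀ ∈ Z, ∃ f ∈ J, ∀ x ∈ X, ∀ y ∈ Y, ∀ y' ∈ Y, ∀ z ∈ Z,
        (x = x₀ ∧ y = y' ∧ z = z₀ → f (x⁻¹ * y * y'⁻¹ * z) = 1) ∧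
        (¬ (x = x₀ ∧ y = y' ∧ z = z₀) → f (x⁻¹ * y * y'⁻¹ * z) = 0)) ∧
      (∑ᶠ χ ∈ Literature.RepresentationTheory.FiniteGroups.irrChars G ∩ (J : Set (G → ℂ)),
        (χ 1).re ^ (2 + ε)) < ((X.card * Y.card * Z.card : ℕ) : ℝ) ^ ((2 + ε) / 3)) := by
  obtain ⟨c, hc, hall⟩ := hlie
  refine sharedWall_gives_crux_unfolded c hc fun R => ?_
  obtain ⟨p, hp, m, k, F, B₂, t, X, Y, Z, hF, hB, hsep, ht, hvol, hdeg⟩ := hall R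
  subst hF
  haveI := hp
  exact ⟨Matrix.GeneralLinearGroup (Fin m) (ZMod p), inferInstance, inferInstance, _,
    B₂, t, X, Y, Z, hB, rankSpan_biInvariant p m k, hsep, ht,
    (by rw [hB]; exact rankSpan_wall_pos p m k), hvol, hdeg⟩


/-! ## Composition -/

/-- **COMPOSITION (closed modulo `stub_lieCellFamilies`).**
`stub_lieCellFamilies → gradedDesignFamily_of_lieCellFamilies` (= Lie-cell glue → `stub_shareUniversality`
→ graded simultaneous family at each `ε` → `gradedWreathLinkAt` → the crux's clause at `ε`); concludes
`…LevelGradedCohnUmans.GradedDesignFamily` by name. -/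
theorem GradedDesignFamily_of : GradedDesignFamily :=
  lieCellFamilies_give_crux_unfolded stub_lieCellFamilies

end Summit.MatrixMultiplication.MatrixMultiplication.Theorems.GradedDesignFamily

end
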